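import Summits.ABC.IUTFork.MLFGaloisTFG
import Literature.NumberTheory.GaloisRepresentations.LocalGaloisCommutatorClosed
import Literature.NumberTheory.GaloisRepresentations.LocalFieldPadicProofs
import HarnessLib

/-!
# The abstract derived subgroup of `G_k` is closed (`k/ℚ_p` finite) — UNCONDITIONAL

Cell `abc-iut` (run/shared/lean/pub/abc-iut/), GAP-LEDGER row G-L3d2g2-1 neighbourhood (F-1977 /
[IUTchI] Rmk 2.5.3 (vi) at `G_k`).  The Literature theorem
`Literature.NumberTheory.GaloisRepresentations.isClosed_commutator_absoluteGaloisGroup_of_dense`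
(`LocalGaloisCommutatorClosed.lean`: uniform commutator width `≤ 2m + 5` in the finite quotients
`Gal(E/k)` — Hartley-type width for the nilpotent-by-metacyclic groups `G₁ ⊲ G₀ ⊲ Gal(E/k)` — and
compactness) needs `Γ_k` topologically finitely generated; that is the tree's UNCONDITIONAL
`Summit.ABC.IUTFork.isTopologicallyFinitelyGenerated_absoluteGaloisGroup_padic` (Summits-side because it
rests on Tate's local Euler–Poincaré characteristic, proved in cell `b2b-bsdres`).  Assembled here:

* `isClosed_commutator_absoluteGaloisGroup_padic` — for every prime `p` and every finite extension
  `K/ℚ_p`, the ABSTRACT commutator subgroup `[Γ_K, Γ_K]` of `Γ_K = Gal(K̄/K)` is closed (so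
  `Γ_K^{ab} = Γ_K / [Γ_K, Γ_K]` with no closure — the `p`-adic instance of the closedness of the derived
  subgroup of a finitely generated profinite group, Nikolov–Segal, Ann. of Math. 165 (2007) Thm 1.4,
  obtained WITHOUT that theorem);
* `commutator_quotient_absoluteGaloisGroup_padic_subset_powProd` — every element of the derived group of
  every finite continuous quotient of `Γ_K` is a product of `2m + 5` commutators, `m` the size of any
  finite topologically generating set.

Independent of (and a different route from) the strong completeness of `Γ_K` landed in
`Literature/NumberTheory/GaloisRepresentations/AbsGaloisStronglyComplete.lean` (seat abc-iut-w6-d103).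
HONEST FRAMING: classical local Galois theory; nothing here asserts anything about abc or takes a side on
[IUTchIII] Cor. 3.12.

## References

* J.-P. Serre, *Corps locaux* (1979), Ch. IV §2, Cor. 5 of Prop. 7. [SerreLocalFields1979]
* J. Neukirch, A. Schmidt, K. Wingberg, *Cohomology of Number Fields* (2008), Thm. 7.5.10.
  [NeukirchSchmidtWingberg2008]
-/

noncomputable section

open scoped Pointwise commutatorElement

namespace Summit.ABC.IUTFork

open Field Literature.AnabelianGeometry.AbsoluteAnabelian Literature.NumberTheory.GaloisRepresentations

/-- A topologically finitely generated group has a finite set generating a DENSE subgroup (coercion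
form used by the `Literature/GroupTheory` strong-completeness files).
[cite: NeukirchSchmidtWingberg2008, Thm. 7.5.10] -/
theorem exists_finset_dense_of_isTopologicallyFinitelyGenerated {G : Type*} [Group G]
    [TopologicalSpace G] [IsTopologicalGroup G] (hG : IsTopologicallyFinitelyGenerated G) :
    ∃ S : Finset G, Dense ((Subgroup.closure (S : Set G) : Subgroup G) : Set G) := by
  obtain ⟨s, hs⟩ := hG.exists_finset
  refine ⟨s, dense_iff_closure_eq.mpr ?_⟩
  rw [← Subgroup.topologicalClosure_coe, hs, Subgroup.coe_top]

/-- **Uniform commutator width of the finite quotients of `G_K`**, `K/ℚ_p` finite, UNCONDITIONAL: if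
the finite set `T` topologically generates `Γ_K` (such `T` exist:
`isTopologicallyFinitelyGenerated_absoluteGaloisGroup_padic`), then for every open normal `U ≤ Γ_K` every
element of `[Γ_K ⧸ U, Γ_K ⧸ U]` is a product of `2·|T| + 5` commutators.
[cite: SerreLocalFields1979, Ch. IV §2 Cor. 5 of Prop. 7] -/
theorem commutator_quotient_absoluteGaloisGroup_padic_subset_powProd (p : ℕ) [Fact p.Prime]
    (K : Type) [Field K] [Algebra ℚ_[p] K] [FiniteDimensional ℚ_[p] K]
    {T : Finset (absoluteGaloisGroup K)}
    (hT : Dense ((Subgroup.closure (T : Set (absoluteGaloisGroup K)) :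
      Subgroup (absoluteGaloisGroup K)) : Set (absoluteGaloisGroup K)))
    (U : OpenNormalSubgroup (absoluteGaloisGroup K)) :
    (commutator (absoluteGaloisGroup K ⧸ (U : Subgroup (absoluteGaloisGroup K))) :
        Set (absoluteGaloisGroup K ⧸ (U : Subgroup (absoluteGaloisGroup K)))) ⊆
      (List.replicate (2 * T.toList.length + 5)
        {c : absoluteGaloisGroup K ⧸ (U : Subgroup (absoluteGaloisGroup K)) |
          ∃ x y : absoluteGaloisGroup K ⧸ (U : Subgroup (absoluteGaloisGroup K)), ⁅x, y⁆ = c}).prod := by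
  haveI : IsNonarchimedeanLocalField ℚ_[p] := Padic.isNonarchimedeanLocalField_holds p
  letI := FiniteExtension.valuativeRel ℚ_[p] K
  letI := FiniteExtension.topologicalSpace ℚ_[p] K
  haveI : IsNonarchimedeanLocalField K := FiniteExtension.isNonarchimedeanLocalField ℚ_[p] K
  exact commutator_quotient_subset_powProd_of_dense K hT U

/-- **The abstract derived subgroup of `G_K = Gal(K̄/K)` is closed, for every finite extension
`K/ℚ_p` — UNCONDITIONAL** (topological finite generation from
`isTopologicallyFinitelyGenerated_absoluteGaloisGroup_padic`; width + compactness from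
`isClosed_commutator_absoluteGaloisGroup_of_dense`).
[cite: SerreLocalFields1979, Ch. IV §2 Cor. 5 of Prop. 7] [cite: NeukirchSchmidtWingberg2008, Thm. 7.5.10] -/
theorem isClosed_commutator_absoluteGaloisGroup_padic (p : ℕ) [Fact p.Prime]
    (K : Type) [Field K] [Algebra ℚ_[p] K] [FiniteDimensional ℚ_[p] K] :
    IsClosed ((commutator (absoluteGaloisGroup K) : Subgroup (absoluteGaloisGroup K)) :
      Set (absoluteGaloisGroup K)) := by
  haveI : IsNonarchimedeanLocalField ℚ_[p] := Padic.isNonarchimedeanLocalField_holds p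
  letI := FiniteExtension.valuativeRel ℚ_[p] K
  letI := FiniteExtension.topologicalSpace ℚ_[p] K
  haveI : IsNonarchimedeanLocalField K := FiniteExtension.isNonarchimedeanLocalField ℚ_[p] K
  obtain ⟨T, hT⟩ := exists_finset_dense_of_isTopologicallyFinitelyGenerated
    (isTopologicallyFinitelyGenerated_absoluteGaloisGroup_padic p K)
  exact isClosed_commutator_absoluteGaloisGroup_of_dense K hT

end Summit.ABC.IUTFork

end
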